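import Summits.CriticalPhenomena.PercolationContinuityZ3.Theorems.Transplant.KNParaChainCorridorNP
import Summits.CriticalPhenomena.PercolationContinuityZ3.Theorems.Transplant.SkelPhiParaParkChain
import HarnessLib

/-!
# N2 (frames-only node `SamePDropOfSkeletonFrm₁`, OPEN), LEVEL 1, (C) column: THE K-G CORRIDOR OF RECORD IN THE x-RUN FRAME — parameters in window
# units, admissibility (= THE SLOT LEDGER), the two joins DISCHARGED, the schedule `Skelφ.kgCorrSched`, its first core and where it ends

One corridor of the oriented scheme (cell `v` → `v + du`, `du` along the frame's axis `0`; the frame `runX φ c₀ n h σ` carries the direction sign,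
the y′-frame is the same frame with the coordinates exchanged) is ONE schedule with parking (`ChainPara.corrSchedNP`, KNParaChainCorridorNP):
* phase 1 — the E-run `xRunPrmB n ℓ h R′ q W N`: `N + 1` strides of along-progress `n`, start box `[−q, q] × [−(P+W), P+W]` (`P = ⌊nℓ/c⌋ + 1` one landing
  piece, `c = n + |h|`), transverse envelope growing by `R′` per stride (`xPrmW` with the window widened by `W`);
* phase 2 — the ACROSS-parking `kgPark₁` = `yParkPrmW` on axis `1`, origin `c₁ = ((N+1)n, 0)`, start box = the run's last core
  (`[−A₁, A₁]` along y′ with `A₁ = P + W + (N+1)R′`, window `q + (N+1)R′` either side), `m₁ + 1` hops;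
* phase 3 — the ALONG-parking `kgPark₂` = `xParkPrmW` on axis `0`, origin `c₂ = ((N+1)n, s)`, start box = phase 2's last core (along `[bLo₁, bHi₁](m₁+1)`,
  window `Wm₂ + Wp₂ =` phase 2's final y′-extent, `s = aHi₁(m₁+1) − Wp₂`), `m₂ + 1` strides.
builds on p205010 (kernel theorem, internal audit signed; external expert review pending) — nothing in this file uses p205010; nothing here is a
claim about the open node `SamePDropOfSkeletonFrm₁`.
Lane `prim-bschramm`, seat `prim-bschramm-p5` (gen 15; (C) lineage; (R-22) K-G, lane INBOX 2026-08-22T19:08:04Z / 20:31:08Z); helper file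
(`--supports stmt-CriticalPhenomena-4575`).
* §1 `xRunPrmB`, `xRunPrmB_ok/_eb`, `kgPark₁`, `kgPark₂`, `kgC₁`, `kgC₂`, **`kgPark₁_ok`**, **`kgPark₂_ok`** (the slot inequalities), `ParkPrm.extent_eq`
  (the along-extent EXACTLY: `max (A − aLo0 − k·(sLo − 2ea − ρ)) (sHi + ρ − 1)`), `kgPark₁_extent` (phase 2's final y′-extent in closed form);
* §2 **`kgJoin₁`**, **`kgJoin₂`** (the two core identities, by `ring` from the four edge equations), **`kgCorrSched`**, `kgCorrSched_params`;
* §3 **`mem_kgCorrSched_core_zero`** (the start box `|y₀| ≤ q ∧ |y₁| ≤ P + W`), **`kgCorrSched_core_last_subset`** (the arrival box, fully explicit: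
  along `[X − (n + ρ − 1), X]` with `X = (N+1)n + q + (N+1)R′ + (m₁+1)(R′ + ρ + |v|) + (m₂+1)(R′ + ρ)`, across
  `[Y − (Wm₂ + Wp₂) − 2(m₂+1)(R′+ρ) , Y]` with `Y = A₁ + (m₁+1)(R′+ρ) + (m₂+1)(R′+ρ)`) — the numbers on which the Geom pen sites `PCells2S.Mb b₀ (v + du)`.
[cite: KozmaNitzan2024, §4 Lemma 11 (pp. 22–23), Lemma 12 (pp. 23–25: arrival in the target box)]
[cite: MartineauTassion2017, §3.2 Lemma 3.5, §4.3 Lemma 4.2 (arXiv:1312.1946 pp. 12–14)]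
-/

noncomputable section

namespace Summit.CriticalPhenomena.PercolationContinuityZ3.Theorems.Transplant

/-! ## §0 The along-extent of a parking phase, exactly -/

namespace ChainPara

/-- **The along-extent of the cores of a parking phase, EXACTLY**: if the start extent is at least the floor `sHi + ρ − 1`, then
`aHi k − aLo k = max (A − aLo0 − k·(sLo − 2ea − ρ)) (sHi + ρ − 1)`. [this work] -/
theorem ParkPrm.extent_eq {P : ParkPrm} (hP : ParkOK P) (h0 : P.sHi + P.ρ - 1 ≤ P.A - P.aLo0) :
    ∀ k : ℕ, P.aHi k - ParkPrm.aLo P k = max (P.A - P.aLo0 - (k : ℤ) * (P.sLo - 2 * P.ea - P.ρ)) (P.sHi + P.ρ - 1)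
  | 0 => by simp [ParkPrm.aHi, ParkPrm.aLo, max_eq_left h0]
  | k + 1 => by
    rw [ParkPrm.extent_succ, ParkPrm.extent_eq hP h0 k]
    have hc : (0 : ℤ) ≤ P.sLo - 2 * P.ea - P.ρ := by have := hP.hcontr; linarith
    push_cast
    set D := P.sLo - 2 * P.ea - P.ρ
    set F := P.sHi + P.ρ - 1
    set E := P.A - P.aLo0
    have e1 : E - (k : ℤ) * D + 2 * P.ea + P.ρ - P.sLo = E - ((k : ℤ) + 1) * D := by simp only [D]; ring
    rcases le_total (E - (k : ℤ) * D) F with h1 | h1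
    · rw [max_eq_right h1, max_eq_right (by nlinarith), max_eq_right (by linarith)]
    · rw [max_eq_left h1, e1]

end ChainPara

namespace Skelφ

open Literature.Probability.Percolation Literature.Probability.LatticeModels SimpleGraph
open Literature.Probability.Percolation.KozmaNitzan.Cells (oth)
open ChainPlanar ChainPara

variable {V : Type}

/-! ## §1 The three parameter records and their admissibility -/

/-- **Phase 1, the E-run with a widened window**: `xPrmW n ℓ h R′ q N` with the transverse window `⌊nℓ/c⌋ + 1 + W` either side. [this work] -/
def xRunPrmB (n ℓ : ℕ) (h : ℤ) (R' q W N : ℕ) : ChainPara.RunPrm :=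
  { xPrmW n ℓ h R' q N with Wp := n * ℓ / shearUnit n h + 1 + W, Wm := n * ℓ / shearUnit n h + 1 + W }

/-- Admissibility of the widened E-run. [folklore] -/
theorem xRunPrmB_ok (n ℓ : ℕ) (h : ℤ) (R' q W N : ℕ) : ChainPara.RunOK (xRunPrmB n ℓ h R' q W N) where
  hs0 := by simp [xRunPrmB, xPrmW]
  hs := le_rfl
  hsL := by simp [xRunPrmB, xPrmW]
  hd := by simp only [xRunPrmB, xPrmW, abs_zero]; positivity
  hPm := by simp [xRunPrmB, xPrmW]
  hPp := by simp [xRunPrmB, xPrmW]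

/-- `eb = ea` for the widened E-run. [folklore] -/
theorem xRunPrmB_eb (n ℓ : ℕ) (h : ℤ) (R' q W N : ℕ) : (xRunPrmB n ℓ h R' q W N).eb = (xRunPrmB n ℓ h R' q W N).ea := rfl

/-- The half-height of the run's last core: `A₁ = ⌊nℓ/c⌋ + 1 + W + (N+1)R′`. [this work] -/
def kgA₁ (n ℓ : ℕ) (h : ℤ) (R' W N : ℕ) : ℕ := n * ℓ / shearUnit n h + 1 + W + (N + 1) * R'

/-- **Phase 2, the ACROSS-parking** (`yParkPrmW` started on the run's last core): along `[−A₁, A₁]`, window `q + (N+1)R′` either side, `m₁ + 1` hops.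
[this work] -/
def kgPark₁ (n ℓ : ℕ) (h v : ℤ) (R' ρ q W N m₁ : ℕ) : ChainPara.ParkPrm :=
  yParkPrmW n ℓ h v R' ρ (-((kgA₁ n ℓ h R' W N : ℕ) : ℤ)) (kgA₁ n ℓ h R' W N) (q + (N + 1) * R') (q + (N + 1) * R') m₁

/-- **Phase 3, the ALONG-parking** (`xParkPrmW` started on phase 2's last core): along `[bLo₁, bHi₁](m₁+1)`, window `(Wm₂, Wp₂)`, `m₂ + 1` strides.
[this work] -/
def kgPark₂ (n ℓ : ℕ) (h v : ℤ) (R' ρ q W N m₁ Wm₂ Wp₂ m₂ : ℕ) : ChainPara.ParkPrm :=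
  xParkPrmW n ℓ h R' ρ ((kgPark₁ n ℓ h v R' ρ q W N m₁).bLo (m₁ + 1)) ((kgPark₁ n ℓ h v R' ρ q W N m₁).bHi (m₁ + 1)) Wm₂ Wp₂ m₂

/-- Origin of phase 2: `((N+1)·n, 0)`. [this work] -/
def kgC₁ (n N : ℕ) : Site 2 := fun j => if j = 0 then (((N + 1) * n : ℕ) : ℤ) else 0

/-- Origin of phase 3: `((N+1)·n, s)` with `s = aHi₁(m₁+1) − Wp₂`. [this work] -/
def kgC₂ (n ℓ : ℕ) (h v : ℤ) (R' ρ q W N m₁ Wp₂ : ℕ) : Site 2 :=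
  fun j => if j = 0 then (((N + 1) * n : ℕ) : ℤ) else (kgPark₁ n ℓ h v R' ρ q W N m₁).aHi (m₁ + 1) - Wp₂

/-- First coordinate of `kgC₁`. [folklore] -/
@[simp] theorem kgC₁_zero (n N : ℕ) : kgC₁ n N 0 = (((N + 1) * n : ℕ) : ℤ) := rfl
/-- Second coordinate of `kgC₁`. [folklore] -/
@[simp] theorem kgC₁_one (n N : ℕ) : kgC₁ n N 1 = 0 := rfl
/-- First coordinate of `kgC₂`. [folklore] -/
@[simp] theorem kgC₂_zero (n ℓ : ℕ) (h v : ℤ) (R' ρ q W N m₁ Wp₂ : ℕ) : kgC₂ n ℓ h v R' ρ q W N m₁ Wp₂ 0 = (((N + 1) * n : ℕ) : ℤ) := rfl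
/-- Second coordinate of `kgC₂`. [folklore] -/
@[simp] theorem kgC₂_one (n ℓ : ℕ) (h v : ℤ) (R' ρ q W N m₁ Wp₂ : ℕ) :
    kgC₂ n ℓ h v R' ρ q W N m₁ Wp₂ 1 = (kgPark₁ n ℓ h v R' ρ q W N m₁).aHi (m₁ + 1) - Wp₂ := rfl

/-- **SLOT LEDGER, phase 2**: the across-parking is admissible when `1 ≤ n`, `|v| ≤ n`, `n + |h| ≤ nℓ + 1`, `2R′ + ρ ≤ ⌊(nℓ − c + 1)/c⌋`,
`ρ + |v| ≤ n`, `n + |v| ≤ q + (N+1)R′`. [this work] -/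
theorem kgPark₁_ok {n ℓ : ℕ} {h v : ℤ} {R' ρ q W N : ℕ} (m₁ : ℕ) (hn : 1 ≤ n) (hv : |v| ≤ n)
    (hlay : (n + h.natAbs : ℕ) ≤ (n : ℤ) * ℓ + 1)
    (hR : (2 * R' + ρ : ℤ) ≤ ((n : ℤ) * ℓ - (shearUnit n h : ℕ) + 1) / (shearUnit n h : ℕ))
    (hρv : (ρ : ℤ) + |v| ≤ n) (hq : (n : ℤ) + |v| ≤ q + (N + 1) * R') :
    ParkOK (kgPark₁ n ℓ h v R' ρ q W N m₁) :=
  yParkPrmW_ok hn hv hlay hR hρv (by push_cast; linarith) (by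
    show -((kgA₁ n ℓ h R' W N : ℕ) : ℤ) ≤ ((kgA₁ n ℓ h R' W N : ℕ) : ℤ)
    linarith [Int.natCast_nonneg (kgA₁ n ℓ h R' W N)])

/-- **SLOT LEDGER, phase 3**: the along-parking is admissible when `1 ≤ n`, `2R′ + ρ ≤ n`, `ρ ≤ ⌊3nℓ/c⌋ + 1`, `2(⌊nℓ/c⌋ + 1) ≤ Wm₂ + Wp₂`
(two landing pieces fit in the start window). [this work] -/
theorem kgPark₂_ok {n ℓ : ℕ} {h v : ℤ} {R' ρ q W N : ℕ} (m₁ : ℕ) {Wm₂ Wp₂ : ℕ} (m₂ : ℕ) (hn : 1 ≤ n) (hR : 2 * R' + ρ ≤ n)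
    (hρL : ρ ≤ 3 * (n * ℓ) / shearUnit n h + 1) (hW : 2 * (n * ℓ / shearUnit n h + 1) ≤ Wm₂ + Wp₂) :
    ParkOK (kgPark₂ n ℓ h v R' ρ q W N m₁ Wm₂ Wp₂ m₂) :=
  xParkPrmW_ok hn hR hρL hW (by
    show (kgPark₁ n ℓ h v R' ρ q W N m₁).bLo (m₁ + 1) ≤ (kgPark₁ n ℓ h v R' ρ q W N m₁).bHi (m₁ + 1)
    simp only [ParkPrm.bLo, ParkPrm.bHi]; push_cast; nlinarith [Int.natCast_nonneg ((kgPark₁ n ℓ h v R' ρ q W N m₁).g),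
      Int.natCast_nonneg (kgPark₁ n ℓ h v R' ρ q W N m₁).Wm, Int.natCast_nonneg (kgPark₁ n ℓ h v R' ρ q W N m₁).Wp])

/-- **Phase 2's final along-extent in closed form**: `aHi₁(m₁+1) − aLo₁(m₁+1) = max (2A₁ − (m₁+1)·(sLo₁ − 2R′ − ρ)) (sHi₁ + ρ − 1)` with
`sLo₁ = ⌊(nℓ − c + 1)/c⌋`, `sHi₁ = ⌊nℓ/c⌋ + 1` (start extent `2A₁ ≥` the floor). [this work] -/
theorem kgPark₁_extent {n ℓ : ℕ} {h v : ℤ} {R' ρ q W N : ℕ} (m₁ : ℕ) (hP : ParkOK (kgPark₁ n ℓ h v R' ρ q W N m₁))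
    (h0 : (n : ℤ) * ℓ / (shearUnit n h : ℕ) + 1 + ρ - 1 ≤ 2 * (kgA₁ n ℓ h R' W N : ℕ)) (k : ℕ) :
    (kgPark₁ n ℓ h v R' ρ q W N m₁).aHi k - ParkPrm.aLo (kgPark₁ n ℓ h v R' ρ q W N m₁) k =
      max (2 * (kgA₁ n ℓ h R' W N : ℕ) - (k : ℤ) * (((n : ℤ) * ℓ - (shearUnit n h : ℕ) + 1) / (shearUnit n h : ℕ) - 2 * R' - ρ))
        ((n : ℤ) * ℓ / (shearUnit n h : ℕ) + 1 + ρ - 1) := by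
  have e := ParkPrm.extent_eq hP (by
    show (n : ℤ) * ℓ / (shearUnit n h : ℕ) + 1 + (ρ : ℤ) - 1 ≤ ((kgA₁ n ℓ h R' W N : ℕ) : ℤ) - -((kgA₁ n ℓ h R' W N : ℕ) : ℤ)
    linarith) k
  rw [e]
  simp only [kgPark₁, yParkPrmW]
  ring_nf

/-! ## §2 The two joins, discharged; the corridor schedule -/

section Sched

variable {n ℓ : ℕ} {h v : ℤ} {R' ρ q W N m₁ Wm₂ Wp₂ m₂ : ℕ}
  (hP₁ : ParkOK (kgPark₁ n ℓ h v R' ρ q W N m₁)) (hP₂ : ParkOK (kgPark₂ n ℓ h v R' ρ q W N m₁ Wm₂ Wp₂ m₂))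
  (hsplit : (Wm₂ : ℤ) + Wp₂ = (kgPark₁ n ℓ h v R' ρ q W N m₁).aHi (m₁ + 1) - ParkPrm.aLo (kgPark₁ n ℓ h v R' ρ q W N m₁) (m₁ + 1))

/-- **JOIN 1**: phase 2's start box IS the run's last core. [this work] -/
theorem kgJoin₁ : ScheduleNP.core ((kgPark₁ n ℓ h v R' ρ q W N m₁).scheduleNP (oth 0) (σ := 1) (Or.inl rfl) (kgC₁ n N) hP₁
      (yParkPrmW_eb n ℓ h v R' ρ _ _ _ _ m₁)) 0 =
    ScheduleNP.core (((xRunPrmB n ℓ h R' q W N).scheduleN 0 (σ := 1) (Or.inl rfl) 0 (xRunPrmB_ok n ℓ h R' q W N)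
      (xRunPrmB_eb n ℓ h R' q W N)).toNPρ ρ) ((xRunPrmB n ℓ h R' q W N).N + 1) := by
  refine park_core_zero_eq_run_core (Or.inl rfl) (xRunPrmB_ok n ℓ h R' q W N) (xRunPrmB_eb n ℓ h R' q W N) hP₁ _ ρ ?_ ?_ ?_ ?_
  · simp only [kgPark₁, yParkPrmW, kgA₁, xRunPrmB, xPrmW, RunPrm.bLo, oth_zero, kgC₁_one, Pi.zero_apply]; push_cast; ring
  · simp only [kgPark₁, yParkPrmW, kgA₁, xRunPrmB, xPrmW, RunPrm.bHi, oth_zero, kgC₁_one, Pi.zero_apply]; push_cast; ring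
  · simp only [kgPark₁, yParkPrmW, xRunPrmB, xPrmW, RunPrm.aLo, kgC₁_zero, Pi.zero_apply]; push_cast; ring
  · simp only [kgPark₁, yParkPrmW, xRunPrmB, xPrmW, RunPrm.aHi, kgC₁_zero, Pi.zero_apply]; push_cast; ring

include hsplit in
/-- **JOIN 2**: phase 3's start box IS phase 2's last core (given the window split `Wm₂ + Wp₂ =` phase 2's final extent). [this work] -/
theorem kgJoin₂ : ScheduleNP.core ((kgPark₂ n ℓ h v R' ρ q W N m₁ Wm₂ Wp₂ m₂).scheduleNP 0 (σ := 1) (Or.inl rfl)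
      (kgC₂ n ℓ h v R' ρ q W N m₁ Wp₂) hP₂ (xParkPrmW_eb n ℓ h R' ρ _ _ _ _ m₂)) 0 =
    ScheduleNP.core ((kgPark₁ n ℓ h v R' ρ q W N m₁).scheduleNP (oth 0) (σ := 1) (Or.inl rfl) (kgC₁ n N) hP₁
      (yParkPrmW_eb n ℓ h v R' ρ _ _ _ _ m₁)) ((kgPark₁ n ℓ h v R' ρ q W N m₁).N + 1) := by
  have hN : (kgPark₁ n ℓ h v R' ρ q W N m₁).N = m₁ := rfl
  refine park_core_zero_eq_park_core (Or.inl rfl) hP₁ (yParkPrmW_eb n ℓ h v R' ρ _ _ _ _ m₁) hP₂ (xParkPrmW_eb n ℓ h R' ρ _ _ _ _ m₂)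
    ?_ ?_ ?_ ?_
  · rw [hN]; simp only [kgC₁_zero, kgC₂_zero, sub_self, mul_zero, add_zero]; rfl
  · rw [hN]; simp only [kgC₁_zero, kgC₂_zero, sub_self, mul_zero, add_zero]; rfl
  · rw [hN]; simp only [oth_zero, kgC₁_one, kgC₂_one]
    show -((Wm₂ : ℕ) : ℤ) = _
    linarith [hsplit]
  · rw [hN]; simp only [oth_zero, kgC₁_one, kgC₂_one]
    show ((Wp₂ : ℕ) : ℤ) = _
    ring

/-- **THE K-G CORRIDOR SCHEDULE OF RECORD** (x-direction, frame sign carried by `runX φ c₀ n h σ`): run ⧺ across-parking ⧺ along-parking in the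
x-run frame, schedule sign `1`, origins `0, kgC₁, kgC₂`. [this work] -/
def kgCorrSched : ScheduleNP :=
  corrSchedNP (xRunPrmB n ℓ h R' q W N) (kgPark₁ n ℓ h v R' ρ q W N m₁) (kgPark₂ n ℓ h v R' ρ q W N m₁ Wm₂ Wp₂ m₂) 0 (σ := 1)
    (Or.inl rfl) 0 (kgC₁ n N) (kgC₂ n ℓ h v R' ρ q W N m₁ Wp₂) (xRunPrmB_ok n ℓ h R' q W N) (xRunPrmB_eb n ℓ h R' q W N) hP₁
    (yParkPrmW_eb n ℓ h v R' ρ _ _ _ _ m₁) hP₂ (xParkPrmW_eb n ℓ h R' ρ _ _ _ _ m₂) rfl rfl rfl (kgJoin₁ hP₁) (kgJoin₂ hP₁ hP₂ hsplit)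

/-- Parameters of the corridor of record: `N + 1 + m₁ + 1 + m₂` steps after the first, radius `R′`, zone radius `ρ`. [folklore] -/
theorem kgCorrSched_params : (kgCorrSched hP₁ hP₂ hsplit).N = N + 1 + m₁ + 1 + m₂ ∧ (kgCorrSched hP₁ hP₂ hsplit).R' = R' ∧
    (kgCorrSched hP₁ hP₂ hsplit).ρ = ρ := ⟨rfl, rfl, rfl⟩

/-! ## §3 The start box and the arrival box -/

/-- **THE START BOX**: `y ∈ core 0 ↔ |y₀| ≤ q ∧ |y₁| ≤ ⌊nℓ/c⌋ + 1 + W`. [this work] -/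
theorem mem_kgCorrSched_core_zero {y : Site 2} : y ∈ (kgCorrSched hP₁ hP₂ hsplit).core 0 ↔
    (-(q : ℤ) ≤ y 0 ∧ y 0 ≤ q) ∧ (-((n * ℓ / shearUnit n h + 1 + W : ℕ) : ℤ) ≤ y 1 ∧ y 1 ≤ ((n * ℓ / shearUnit n h + 1 + W : ℕ) : ℤ)) := by
  rw [kgCorrSched, mem_corrSchedNP_core_zero]
  simp only [xRunPrmB, xPrmW, oth_zero, Pi.zero_apply, sub_zero, one_mul]

/-- **THE ARRIVAL BOX, EXPLICIT**: if phase 3 parks (`2(q + (N+1)R′) + 2(m₁+1)(R′ + ρ + |v|) ≤ n + ρ − 1 + (m₂+1)(n − 2R′ − ρ)`), every point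
`y` of the last core has `X − (n + ρ − 1) ≤ y₀ − (N+1)n ≤ X` with `X = q + (N+1)R′ + (m₁+1)(R′ + ρ + |v|) + (m₂+1)(R′ + ρ)` and
`−Wm₂ − (m₂+1)(R′+ρ) ≤ y₁ − s ≤ Wp₂ + (m₂+1)(R′+ρ)` with `s = A₁ + (m₁+1)(R′+ρ) − Wp₂`. [this work] -/
theorem kgCorrSched_core_last_subset
    (hpark : 2 * ((q : ℤ) + (N + 1) * R') + 2 * ((m₁ : ℤ) + 1) * (R' + ρ + |v|) ≤ (n : ℤ) + ρ - 1 + ((m₂ : ℤ) + 1) * ((n : ℤ) - 2 * R' - ρ))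
    {y : Site 2} (hy : y ∈ (kgCorrSched hP₁ hP₂ hsplit).core ((kgCorrSched hP₁ hP₂ hsplit).N + 1)) :
    ((q : ℤ) + (N + 1) * R' + ((m₁ : ℤ) + 1) * (R' + ρ + |v|) + ((m₂ : ℤ) + 1) * (R' + ρ) - ((n : ℤ) + ρ - 1) ≤ y 0 - (N + 1) * n ∧
      y 0 - (N + 1) * n ≤ (q : ℤ) + (N + 1) * R' + ((m₁ : ℤ) + 1) * (R' + ρ + |v|) + ((m₂ : ℤ) + 1) * (R' + ρ)) ∧
    (-(Wm₂ : ℤ) - ((m₂ : ℤ) + 1) * (R' + ρ) ≤ y 1 - (((kgA₁ n ℓ h R' W N : ℕ) : ℤ) + ((m₁ : ℤ) + 1) * (R' + ρ) - Wp₂) ∧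
      y 1 - (((kgA₁ n ℓ h R' W N : ℕ) : ℤ) + ((m₁ : ℤ) + 1) * (R' + ρ) - Wp₂) ≤ (Wp₂ : ℤ) + ((m₂ : ℤ) + 1) * (R' + ρ)) := by
  have hg₁ : ((kgPark₁ n ℓ h v R' ρ q W N m₁).g : ℤ) = R' + ρ + |v| := by
    rw [ParkPrm.g_eq]; simp [kgPark₁, yParkPrmW]
  have hg₂ : ((kgPark₂ n ℓ h v R' ρ q W N m₁ Wm₂ Wp₂ m₂).g : ℤ) = R' + ρ := by
    rw [ParkPrm.g_eq]; simp [kgPark₂, xParkPrmW]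
  have hA₂ : (kgPark₂ n ℓ h v R' ρ q W N m₁ Wm₂ Wp₂ m₂).A = (q : ℤ) + (N + 1) * R' + ((m₁ : ℤ) + 1) * (R' + ρ + |v|) := by
    show (kgPark₁ n ℓ h v R' ρ q W N m₁).bHi (m₁ + 1) = _
    simp only [ParkPrm.bHi]; push_cast; rw [hg₁]; simp [kgPark₁, yParkPrmW]
  have hA₂' : (kgPark₂ n ℓ h v R' ρ q W N m₁ Wm₂ Wp₂ m₂).aLo0 = -((q : ℤ) + (N + 1) * R') - ((m₁ : ℤ) + 1) * (R' + ρ + |v|) := by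
    show (kgPark₁ n ℓ h v R' ρ q W N m₁).bLo (m₁ + 1) = _
    simp only [ParkPrm.bLo]; push_cast; rw [hg₁]; simp [kgPark₁, yParkPrmW]
  have hpark' : (kgPark₂ n ℓ h v R' ρ q W N m₁ Wm₂ Wp₂ m₂).A - (kgPark₂ n ℓ h v R' ρ q W N m₁ Wm₂ Wp₂ m₂).aLo0 ≤
      (kgPark₂ n ℓ h v R' ρ q W N m₁ Wm₂ Wp₂ m₂).sHi + (kgPark₂ n ℓ h v R' ρ q W N m₁ Wm₂ Wp₂ m₂).ρ - 1 +
        (((kgPark₂ n ℓ h v R' ρ q W N m₁ Wm₂ Wp₂ m₂).N + 1 : ℕ) : ℤ) *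
          ((kgPark₂ n ℓ h v R' ρ q W N m₁ Wm₂ Wp₂ m₂).sLo - 2 * (kgPark₂ n ℓ h v R' ρ q W N m₁ Wm₂ Wp₂ m₂).ea -
            (kgPark₂ n ℓ h v R' ρ q W N m₁ Wm₂ Wp₂ m₂).ρ) := by
    rw [hA₂, hA₂']
    simp only [kgPark₂, xParkPrmW]; push_cast; linarith
  have hlast := corrSchedNP_core_last_subset (xRunPrmB n ℓ h R' q W N) (kgPark₁ n ℓ h v R' ρ q W N m₁)
    (kgPark₂ n ℓ h v R' ρ q W N m₁ Wm₂ Wp₂ m₂) 0 (σ := 1) (Or.inl rfl) 0 (kgC₁ n N) (kgC₂ n ℓ h v R' ρ q W N m₁ Wp₂)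
    (xRunPrmB_ok n ℓ h R' q W N) (xRunPrmB_eb n ℓ h R' q W N) hP₁ (yParkPrmW_eb n ℓ h v R' ρ _ _ _ _ m₁) hP₂
    (xParkPrmW_eb n ℓ h R' ρ _ _ _ _ m₂) rfl rfl rfl (kgJoin₁ hP₁) (kgJoin₂ hP₁ hP₂ hsplit) hpark' hy
  rw [hA₂, hg₂] at hlast
  simp only [oth_zero, kgC₂_zero, kgC₂_one, one_mul] at hlast
  have eHi : (kgPark₁ n ℓ h v R' ρ q W N m₁).aHi (m₁ + 1) = ((kgA₁ n ℓ h R' W N : ℕ) : ℤ) + ((m₁ : ℤ) + 1) * (R' + ρ) := by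
    simp only [ParkPrm.aHi, kgPark₁, yParkPrmW]; push_cast; ring
  rw [eHi] at hlast
  have e2 : ((kgPark₂ n ℓ h v R' ρ q W N m₁ Wm₂ Wp₂ m₂).N : ℤ) = m₂ := rfl
  have e3 : ((kgPark₂ n ℓ h v R' ρ q W N m₁ Wm₂ Wp₂ m₂).ea : ℤ) = R' := rfl
  have e4 : ((kgPark₂ n ℓ h v R' ρ q W N m₁ Wm₂ Wp₂ m₂).ρ : ℤ) = ρ := rfl
  have e5 : (kgPark₂ n ℓ h v R' ρ q W N m₁ Wm₂ Wp₂ m₂).sHi = n := rfl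
  have e6 : ((kgPark₂ n ℓ h v R' ρ q W N m₁ Wm₂ Wp₂ m₂).Wm : ℤ) = Wm₂ := rfl
  have e7 : ((kgPark₂ n ℓ h v R' ρ q W N m₁ Wm₂ Wp₂ m₂).Wp : ℤ) = Wp₂ := rfl
  simp only [Nat.cast_add, Nat.cast_one, e2, e3, e4, e5, e6, e7, Nat.cast_mul] at hlast
  obtain ⟨⟨h1, h2⟩, h3, h4⟩ := hlast
  refine ⟨⟨by linarith, by linarith⟩, by linarith, by linarith⟩

end Sched

end Skelφ

end Summit.CriticalPhenomena.PercolationContinuityZ3.Theorems.Transplant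

end
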